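/-
Copyright (c) 2026 the pub-hodgecm-mathlib formalisation cell (harness21).  Prover seat hodgecm-mathlib-LH4-p08 (g8), req620 Track A «(D-RAM) FOUR-FRAME» squad, helper lane
on h413 = stmt-HodgeConjecture-24833 (count-neutral).  STAGE-1b, row (2) cone road (LH4-p07 (g9) LAW-FIT 95e6878a §2; dealer∕pen LH4-plan (g13) WORD #65 (2)):
(T5s♭-Unr) «THE TYPE-U TORIC CENSUS SUM IN THE FLIPPED PARITY CLASS».  2026-09-04.
-/
import Summits.HodgeConjecture.HodgeConjecture.Theorems.F0P3cDyRamToricCensusSumUnrV5   -- ★ p857461 T5s TYPE U SHEET v5 (LH4-p04 (g3)): `sumP_eval_v5`, `sumM_eval_v5`; brings ★ `low_block_mul`, `alt_index_sum`, `geom_sum_mul'`, `geom_sum_two_mul`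
import HarnessLib

/-!
# Crux `H413`, line LH4 «(D-RAM) FOUR-FRAME» — STAGE-1b, row (2): (T5s♭-Unr) «THE TYPE-U TORIC CENSUS SUM (SHEET v5) IN THE FLIPPED PARITY CLASS `jl` ODD, `m ≢ d`»
# `ε·Σ_{j ≤ jl} Σ_a q^a (dep₊(j,a) − dep₋(j,a)) = q^m·(1 + (q+1)[⌊jl∕2⌋ + d%2]_q − 2[d − 1 + d%2]_q)`

Cell `hodgecm-mathlib` (D-0151), FLOOR 0, crux item H413 = `stmt-HodgeConjecture-24833`, route of record `HCCMUnconditional`; squad F0∕P3c∕LH4 (req618∕req620); helper lane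
`--supports stmt-HodgeConjecture-24833 --as helper` (count-neutral).  THEOREMS ONLY (no `def`, no instance, no notation, no `sorry`; default heartbeats).  Pure finite-sum
bookkeeping over `ℚ` (no lattices) on the ABSTRACT tables of ★ p857461 `toricCensusSum_unr_v5` (sheet v5 — the head ★ `toricCensusSum_unr_weld` welds to the ★ T5a counts).

WHY.  ★ p859713 (LH4-p07 (g9), (T5-P-cut)) reads the `G`-side census of a level template piece `lev_{a′,b′}` as the UNIT one-multiplier census in the tokens
`(m₁, jl₁) = (m − a′, jl − a′)` of its shallower multiplier `μ₁`.  For type U the unit's tokens have `jl` EVEN and, on the ε = 1 branch, `m ≡ d (2)` (★ v5's `hjl`, `hreal`); for an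
ODD `a′` (one of `lev_{ℓ₀, m*}`, `lev_{ℓ₀+1, m*}` at every `d`) the shifted tokens therefore sit in the FLIPPED class `jl₁` odd, `m₁ ≢ d` (the ε = −1 shape `m₁ = jl₁ − d + 1` is
unchanged) — outside ★ v5's hypotheses (LH4-p07 LAW-FIT §2 (a)∕(c)).  THIS FILE sums the SAME abstract tables on that class:
* `algebra_pos_flip` ∕ `algebra_neg_flip` — the arithmetic of the two branches (★ `sumP_eval_v5` − ★ `sumM_eval_v5` are parity-free; one `(x−1)`-clearing by ★ `low_block_mul`,
  ★ `geom_sum_mul'`, ★ `geom_sum_two_mul`, then `ring` in the atoms `x^L, x^{⌊m∕2⌋}, x^{S∕2−1}, x` per parity of `d`; `jl − d` and `m` have the OPPOSITE parities to ★ v5's);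
* **`toricCensusSum_unr_v5_flip`** — ★ `toricCensusSum_unr_v5`'s binders VERBATIM with TWO letters flipped (`hjl : jl % 2 = 1`; `m % 2 ≠ d % 2` on the ε = 1 branch of `hreal`),
  value `q^m·((1 + (q+1)·Σ_{i<jl∕2 + d%2} q^i) − 2·Σ_{i<d−1+d%2} q^i)` (★ v5: `Σ_{i<jl∕2}`, `Σ_{i<d−d%2}`; the odd constant `d − 1 + d%2` is also LH4-p07's RamK♭ constant).
EVIDENCE before typing (python twin of the abstract ★ v5 tables, `F0/P3c/LH4/LH4-p08/g8/t5s_unr_twin.v1` + `t5s_unr_fit_flip.v1`): sanity ★ v5 180∕180 and ★ sheet-v3 222∕222 on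
their realizable sets; the flipped ε = 1 class 465∕465 (q ≤ 4, d ≤ 7, jl ≤ 19), the ε = −1 class on every printed case; the sheet-v3 tables MISS the law for d ≥ 4.  The (R2)
cut twin on this class is this head minus the same two top bands of ★ `…ToricCensusSumUnrV5Cutoff` (`cutP_eval`∕`cutM_eval` are parity-free).  END signature
`F0/P3c/LH4/LH4-p08/g8/SIG-T5sFlip-Unr.v1` ef1f1492.
HONEST LABEL.  Count-neutral (`--supports`): nothing printed is asserted; no census LAW is stated (abstract tables; the weld at `μ₁` is the (LAW) assembly's); pays no registered
stub and touches no `Lines/` module; the seven tier-0 ED. 5 sorries stay OPEN; `HC_CM` is proved only modulo the 7 printed citations (2 remaining named inputs: hLiu418 =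
`stmt-HodgeConjecture-24832`, h413 = `stmt-HodgeConjecture-24833`) until rung 0 closes.

## References
* [Kottwitz1986BaseChangeUnits] R. E. Kottwitz, *Base change for unit elements of Hecke algebras*, Compositio Math. 60 (1986), §1 pp. 240–241 (orbital integrals of units as
  lattice counts modulo the torus).
* [Rogawski1990] J. D. Rogawski, *Automorphic Representations of Unitary Groups in Three Variables*, Ann. of Math. Stud. 123 (1990), §4.9 Prop. 4.9.1 (b) p. 55, Lemma 4.9.3 p. 56
  (the fixed-point census of a type-(2) element; the toric decomposition).
* [Flicker1998UnitaryFL] Y. Z. Flicker, *Elementary proof of the fundamental lemma for a unitary group*, Canad. J. Math. 50 (1998), Prop. 7 p. 84 (the level tables).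
-/

set_option autoImplicit false

namespace Summit.HodgeConjecture.HodgeConjecture.Cruxes.H413.F0P3cDyRamToricCensusSumUnrV5Flip

open Finset
open Summit.HodgeConjecture.HodgeConjecture.Cruxes.H413.F0P3cDyRamToricCensusSumUnrBlocks (geom_sum_mul' geom_sum_two_mul alt_index_sum)
open Summit.HodgeConjecture.HodgeConjecture.Cruxes.H413.F0P3cDyRamToricCensusSumUnrParts (low_block_mul)
open Summit.HodgeConjecture.HodgeConjecture.Cruxes.H413.F0P3cDyRamToricCensusSumUnrV5Parts (sumP_eval_v5 sumM_eval_v5)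

/-! ## §1 The arithmetic of the two branches in the flipped class -/

/-- Powers with equal exponents (bookkeeping for the atom rewrites). [folklore] -/
theorem pow_congr_exp (x : ℚ) {a b : ℕ} (h : a = b) : x ^ a = x ^ b := by rw [h]

/-- THE ARITHMETIC, `ε = +1` branch of the FLIPPED class (`m ≢ d (mod 2)`, `jl` odd, `S − 1 ≤ m`, `m + d ≤ jl`, `S = d − d%2`): after one multiplication by `x − 1` the
`(x+1)`-blocks telescope and everything collapses to `x^m((x+1)x^{⌊jl∕2⌋ + d%2} − 2x^{d−1+d%2} + 1)`; `ring` in the atoms `x^L, x^{⌊m∕2⌋}, x^{S∕2−1}, x` per parity of `d`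
(`jl − d` and `m` have the opposite parities to ★ `algebra_pos_v5`'s). [folklore] -/
theorem algebra_pos_flip (x : ℚ) (hx1 : x ≠ 1) {d jl m : ℕ} (hd : 2 ≤ d) (hpar : m % 2 ≠ d % 2) (hmS : d - d % 2 ≤ m + 1) (hmd : m + d ≤ jl) (hjl : jl % 2 = 1)
    (A0P A0M : ℚ) (hA0 : A0P - A0M = -x ^ (d - 1)) :
    (A0P + (x + 1) * x ^ (d - 1) * ∑ u ∈ range ((jl - d) / 2 + 1), x ^ u +
        ∑ i ∈ range (m / 2), (x ^ 2 - 1) * x ^ (2 * i + d) * ∑ u ∈ range ((jl - d) / 2 - i), x ^ u +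
        (x + 1) * x ^ (m / 2 + 1 + (d + (jl - m - d) / 2 + m / 2 - 1)) * ∑ i ∈ range ((2 * m + 1 - d) / 2 - m / 2), x ^ i) -
      (A0M + (x + 1) * x ^ d * ∑ i ∈ range (m / 2), x ^ (2 * i)) =
      x ^ m * ((1 + (x + 1) * ∑ i ∈ range (jl / 2 + d % 2), x ^ i) - 2 * ∑ i ∈ range (d - 1 + d % 2), x ^ i) := by
  set L := (jl - d) / 2 with hL
  set h := m / 2 with hh
  set p := (d - d % 2) / 2 - 1 with hp
  have hhL : h ≤ L := by omega
  apply mul_left_cancel₀ (sub_ne_zero.2 hx1)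
  have t1 : (x - 1) * ((x + 1) * x ^ (d - 1) * ∑ u ∈ range (L + 1), x ^ u) = (x + 1) * x ^ (d - 1) * (x ^ L * x - 1) := by
    rw [show (x - 1) * ((x + 1) * x ^ (d - 1) * ∑ u ∈ range (L + 1), x ^ u) = (x + 1) * x ^ (d - 1) * ((x - 1) * ∑ u ∈ range (L + 1), x ^ u) by ring,
      geom_sum_mul', pow_succ]
  have t2 := low_block_mul x (d := d) (L := L) (h := h) (by omega) hhL
  have t3 : (x - 1) * ((x + 1) * x ^ (h + 1 + (d + (jl - m - d) / 2 + h - 1)) * ∑ i ∈ range ((2 * m + 1 - d) / 2 - h), x ^ i) =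
      (x + 1) * (x ^ (h + 1 + (d + (jl - m - d) / 2 + h - 1)) * x ^ ((2 * m + 1 - d) / 2 - h) - x ^ (h + 1 + (d + (jl - m - d) / 2 + h - 1))) := by
    rw [show (x - 1) * ((x + 1) * x ^ (h + 1 + (d + (jl - m - d) / 2 + h - 1)) * ∑ i ∈ range ((2 * m + 1 - d) / 2 - h), x ^ i) =
      (x + 1) * x ^ (h + 1 + (d + (jl - m - d) / 2 + h - 1)) * ((x - 1) * ∑ i ∈ range ((2 * m + 1 - d) / 2 - h), x ^ i) by ring, geom_sum_mul']
    ring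
  have t4 : (x - 1) * ((x + 1) * x ^ d * ∑ i ∈ range h, x ^ (2 * i)) = x ^ d * (x ^ (2 * h) - 1) := by
    rw [show (x - 1) * ((x + 1) * x ^ d * ∑ i ∈ range h, x ^ (2 * i)) = x ^ d * ((x ^ 2 - 1) * ∑ i ∈ range h, x ^ (2 * i)) by ring, geom_sum_two_mul]
  have t5 : (x - 1) * (x ^ m * ((1 + (x + 1) * ∑ i ∈ range (jl / 2 + d % 2), x ^ i) - 2 * ∑ i ∈ range (d - 1 + d % 2), x ^ i)) =
      x ^ m * ((x - 1) + (x + 1) * (x ^ (jl / 2 + d % 2) - 1) - 2 * (x ^ (d - 1 + d % 2) - 1)) := by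
    rw [show (x - 1) * (x ^ m * ((1 + (x + 1) * ∑ i ∈ range (jl / 2 + d % 2), x ^ i) - 2 * ∑ i ∈ range (d - 1 + d % 2), x ^ i)) =
      x ^ m * ((x - 1) + (x + 1) * ((x - 1) * ∑ i ∈ range (jl / 2 + d % 2), x ^ i) - 2 * ((x - 1) * ∑ i ∈ range (d - 1 + d % 2), x ^ i)) by ring,
      geom_sum_mul', geom_sum_mul']
  rw [show (x - 1) * (A0P + (x + 1) * x ^ (d - 1) * ∑ u ∈ range (L + 1), x ^ u +
        ∑ i ∈ range h, (x ^ 2 - 1) * x ^ (2 * i + d) * ∑ u ∈ range (L - i), x ^ u +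
        (x + 1) * x ^ (h + 1 + (d + (jl - m - d) / 2 + h - 1)) * ∑ i ∈ range ((2 * m + 1 - d) / 2 - h), x ^ i -
      (A0M + (x + 1) * x ^ d * ∑ i ∈ range h, x ^ (2 * i))) =
      (x - 1) * (A0P - A0M) + (x - 1) * ((x + 1) * x ^ (d - 1) * ∑ u ∈ range (L + 1), x ^ u) +
        (x - 1) * ∑ i ∈ range h, (x ^ 2 - 1) * x ^ (2 * i + d) * ∑ u ∈ range (L - i), x ^ u +
        (x - 1) * ((x + 1) * x ^ (h + 1 + (d + (jl - m - d) / 2 + h - 1)) * ∑ i ∈ range ((2 * m + 1 - d) / 2 - h), x ^ i) -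
      (x - 1) * ((x + 1) * x ^ d * ∑ i ∈ range h, x ^ (2 * i)) by ring,
    hA0, t1, t2, t3, t4, t5]
  -- atoms `x^L`, `x^h`, `x^p` (`p = S∕2 − 1`), `x`, per parity of `d`
  rcases Nat.mod_two_eq_zero_or_one d with hδ | hδ
  · -- `d` even: `d = 2p + 2`, `m = 2h + 1`, `jl − d = 2L + 1`
    have f1 : x ^ (d - 1) = x ^ p * x ^ p * x := by
      rw [show x ^ p * x ^ p * x = x ^ (p + p + 1) by ring]; exact pow_congr_exp x (by omega)
    have f2 : x ^ d = x ^ p * x ^ p * x * x := by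
      rw [show x ^ p * x ^ p * x * x = x ^ (p + p + 2) by ring]; exact pow_congr_exp x (by omega)
    have f3 : x ^ (2 * h) = x ^ h * x ^ h := by
      rw [show x ^ h * x ^ h = x ^ (h + h) by ring]; exact pow_congr_exp x (by omega)
    have f4 : x ^ (h + 1 + (d + (jl - m - d) / 2 + h - 1)) = x ^ h * x ^ p * x ^ p * x ^ L * x * x := by
      rw [show x ^ h * x ^ p * x ^ p * x ^ L * x * x = x ^ (h + p + p + L + 2) by ring]; exact pow_congr_exp x (by omega)
    have f5 : x ^ h * x ^ p * x ^ p * x ^ L * x * x * x ^ ((2 * m + 1 - d) / 2 - h) = x ^ h * x ^ h * x ^ p * x ^ L * x * x := by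
      rw [show x ^ h * x ^ p * x ^ p * x ^ L * x * x * x ^ ((2 * m + 1 - d) / 2 - h) = x ^ (h + p + p + L + 2 + ((2 * m + 1 - d) / 2 - h)) by ring,
        show x ^ h * x ^ h * x ^ p * x ^ L * x * x = x ^ (h + h + p + L + 2) by ring]
      exact pow_congr_exp x (by omega)
    have f6 : x ^ m = x ^ h * x ^ h * x := by
      rw [show x ^ h * x ^ h * x = x ^ (h + h + 1) by ring]; exact pow_congr_exp x (by omega)
    have f7 : x ^ (jl / 2 + d % 2) = x ^ L * x ^ p * x := by
      rw [show x ^ L * x ^ p * x = x ^ (L + p + 1) by ring]; exact pow_congr_exp x (by omega)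
    have f8 : x ^ (d - 1 + d % 2) = x ^ p * x ^ p * x := by
      rw [show x ^ p * x ^ p * x = x ^ (p + p + 1) by ring]; exact pow_congr_exp x (by omega)
    rw [f4, f5, f1, f2, f3, f6, f7, f8]; ring
  · -- `d` odd: `d = 2p + 3`, `m = 2h`, `jl − d = 2L`
    have f1 : x ^ (d - 1) = x ^ p * x ^ p * x * x := by
      rw [show x ^ p * x ^ p * x * x = x ^ (p + p + 2) by ring]; exact pow_congr_exp x (by omega)
    have f2 : x ^ d = x ^ p * x ^ p * x * x * x := by
      rw [show x ^ p * x ^ p * x * x * x = x ^ (p + p + 3) by ring]; exact pow_congr_exp x (by omega)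
    have f3 : x ^ (2 * h) = x ^ h * x ^ h := by
      rw [show x ^ h * x ^ h = x ^ (h + h) by ring]; exact pow_congr_exp x (by omega)
    have f4 : x ^ (h + 1 + (d + (jl - m - d) / 2 + h - 1)) = x ^ h * x ^ p * x ^ p * x ^ L * x * x * x := by
      rw [show x ^ h * x ^ p * x ^ p * x ^ L * x * x * x = x ^ (h + p + p + L + 3) by ring]; exact pow_congr_exp x (by omega)
    have f5 : x ^ h * x ^ p * x ^ p * x ^ L * x * x * x * x ^ ((2 * m + 1 - d) / 2 - h) = x ^ h * x ^ h * x ^ p * x ^ L * x * x := by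
      rw [show x ^ h * x ^ p * x ^ p * x ^ L * x * x * x * x ^ ((2 * m + 1 - d) / 2 - h) = x ^ (h + p + p + L + 3 + ((2 * m + 1 - d) / 2 - h)) by ring,
        show x ^ h * x ^ h * x ^ p * x ^ L * x * x = x ^ (h + h + p + L + 2) by ring]
      exact pow_congr_exp x (by omega)
    have f6 : x ^ m = x ^ h * x ^ h := by
      rw [show x ^ h * x ^ h = x ^ (h + h) by ring]; exact pow_congr_exp x (by omega)
    have f7 : x ^ (jl / 2 + d % 2) = x ^ L * x ^ p * x * x := by
      rw [show x ^ L * x ^ p * x * x = x ^ (L + p + 2) by ring]; exact pow_congr_exp x (by omega)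
    have f8 : x ^ (d - 1 + d % 2) = x ^ p * x ^ p * x * x * x := by
      rw [show x ^ p * x ^ p * x * x * x = x ^ (p + p + 3) by ring]; exact pow_congr_exp x (by omega)
    rw [f4, f5, f1, f2, f3, f6, f7, f8]; ring

/-- THE ARITHMETIC, `ε = −1` branch of the FLIPPED class (`m = jl − d + 1`, `jl` odd, `S − 1 ≤ m`): the `+` side has no diagonal, the `−` side is all diagonal; same
collapse (`m` and `jl − d` have the opposite parities to ★ `algebra_neg_v5`'s). [folklore] -/
theorem algebra_neg_flip (x : ℚ) (hx1 : x ≠ 1) {d jl m : ℕ} (hd : 2 ≤ d) (hdjl : d ≤ jl) (hm : m = jl - d + 1) (hmS : d - d % 2 ≤ m + 1) (hjl : jl % 2 = 1)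
    (A0P A0M : ℚ) (hA0 : A0P - A0M = -x ^ (d - 1)) :
    (-1) * ((A0P + (x + 1) * x ^ (d - 1) * ∑ u ∈ range ((jl - d) / 2 + 1), x ^ u +
        ∑ i ∈ range (min (m / 2) ((jl - d) / 2)), (x ^ 2 - 1) * x ^ (2 * i + d) * ∑ u ∈ range ((jl - d) / 2 - i), x ^ u + 0) -
      (A0M + (x + 1) * x ^ d * ∑ i ∈ range (m / 2), x ^ (2 * i) +
        (x + 1) * x ^ (d + m - 1) * ∑ i ∈ range ((2 * jl + 1 - d) / 2 + 1 - (d + m / 2)), x ^ i)) =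
      x ^ m * ((1 + (x + 1) * ∑ i ∈ range (jl / 2 + d % 2), x ^ i) - 2 * ∑ i ∈ range (d - 1 + d % 2), x ^ i) := by
  set L := (jl - d) / 2 with hL
  set p := (d - d % 2) / 2 - 1 with hp
  rw [min_eq_right (by omega : L ≤ m / 2), add_zero]
  apply mul_left_cancel₀ (sub_ne_zero.2 hx1)
  have t1 : (x - 1) * ((x + 1) * x ^ (d - 1) * ∑ u ∈ range (L + 1), x ^ u) = (x + 1) * x ^ (d - 1) * (x ^ L * x - 1) := by
    rw [show (x - 1) * ((x + 1) * x ^ (d - 1) * ∑ u ∈ range (L + 1), x ^ u) = (x + 1) * x ^ (d - 1) * ((x - 1) * ∑ u ∈ range (L + 1), x ^ u) by ring,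
      geom_sum_mul', pow_succ]
  have t2 := low_block_mul x (d := d) (L := L) (h := L) (by omega) le_rfl
  have t4 : (x - 1) * ((x + 1) * x ^ d * ∑ i ∈ range (m / 2), x ^ (2 * i)) = x ^ d * (x ^ (2 * (m / 2)) - 1) := by
    rw [show (x - 1) * ((x + 1) * x ^ d * ∑ i ∈ range (m / 2), x ^ (2 * i)) = x ^ d * ((x ^ 2 - 1) * ∑ i ∈ range (m / 2), x ^ (2 * i)) by ring, geom_sum_two_mul]
  have t6 : (x - 1) * ((x + 1) * x ^ (d + m - 1) * ∑ i ∈ range ((2 * jl + 1 - d) / 2 + 1 - (d + m / 2)), x ^ i) =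
      (x + 1) * (x ^ (d + m - 1) * x ^ ((2 * jl + 1 - d) / 2 + 1 - (d + m / 2)) - x ^ (d + m - 1)) := by
    rw [show (x - 1) * ((x + 1) * x ^ (d + m - 1) * ∑ i ∈ range ((2 * jl + 1 - d) / 2 + 1 - (d + m / 2)), x ^ i) =
      (x + 1) * x ^ (d + m - 1) * ((x - 1) * ∑ i ∈ range ((2 * jl + 1 - d) / 2 + 1 - (d + m / 2)), x ^ i) by ring, geom_sum_mul']
    ring
  have t5 : (x - 1) * (x ^ m * ((1 + (x + 1) * ∑ i ∈ range (jl / 2 + d % 2), x ^ i) - 2 * ∑ i ∈ range (d - 1 + d % 2), x ^ i)) =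
      x ^ m * ((x - 1) + (x + 1) * (x ^ (jl / 2 + d % 2) - 1) - 2 * (x ^ (d - 1 + d % 2) - 1)) := by
    rw [show (x - 1) * (x ^ m * ((1 + (x + 1) * ∑ i ∈ range (jl / 2 + d % 2), x ^ i) - 2 * ∑ i ∈ range (d - 1 + d % 2), x ^ i)) =
      x ^ m * ((x - 1) + (x + 1) * ((x - 1) * ∑ i ∈ range (jl / 2 + d % 2), x ^ i) - 2 * ((x - 1) * ∑ i ∈ range (d - 1 + d % 2), x ^ i)) by ring,
      geom_sum_mul', geom_sum_mul']
  rw [show (x - 1) * ((-1) * ((A0P + (x + 1) * x ^ (d - 1) * ∑ u ∈ range (L + 1), x ^ u +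
        ∑ i ∈ range L, (x ^ 2 - 1) * x ^ (2 * i + d) * ∑ u ∈ range (L - i), x ^ u) -
      (A0M + (x + 1) * x ^ d * ∑ i ∈ range (m / 2), x ^ (2 * i) +
        (x + 1) * x ^ (d + m - 1) * ∑ i ∈ range ((2 * jl + 1 - d) / 2 + 1 - (d + m / 2)), x ^ i))) =
      -((x - 1) * (A0P - A0M) + (x - 1) * ((x + 1) * x ^ (d - 1) * ∑ u ∈ range (L + 1), x ^ u) +
        (x - 1) * ∑ i ∈ range L, (x ^ 2 - 1) * x ^ (2 * i + d) * ∑ u ∈ range (L - i), x ^ u -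
        (x - 1) * ((x + 1) * x ^ d * ∑ i ∈ range (m / 2), x ^ (2 * i)) -
        (x - 1) * ((x + 1) * x ^ (d + m - 1) * ∑ i ∈ range ((2 * jl + 1 - d) / 2 + 1 - (d + m / 2)), x ^ i)) by ring,
    hA0, t1, t2, t4, t6, t5]
  rcases Nat.mod_two_eq_zero_or_one d with hδ | hδ
  · -- `d` even: `jl − d = 2L + 1`, `m = 2L + 2`, `⌊m∕2⌋ = L + 1`
    have f1 : x ^ (d - 1) = x ^ p * x ^ p * x := by
      rw [show x ^ p * x ^ p * x = x ^ (p + p + 1) by ring]; exact pow_congr_exp x (by omega)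
    have f2 : x ^ d = x ^ p * x ^ p * x * x := by
      rw [show x ^ p * x ^ p * x * x = x ^ (p + p + 2) by ring]; exact pow_congr_exp x (by omega)
    have f3 : x ^ (2 * (m / 2)) = x ^ L * x ^ L * x * x := by
      rw [show x ^ L * x ^ L * x * x = x ^ (L + L + 2) by ring]; exact pow_congr_exp x (by omega)
    have f4 : x ^ (d + m - 1) = x ^ L * x ^ L * x ^ p * x ^ p * x * x * x := by
      rw [show x ^ L * x ^ L * x ^ p * x ^ p * x * x * x = x ^ (L + L + p + p + 3) by ring]; exact pow_congr_exp x (by omega)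
    have f5 : x ^ L * x ^ L * x ^ p * x ^ p * x * x * x * x ^ ((2 * jl + 1 - d) / 2 + 1 - (d + m / 2)) = x ^ L * x ^ L * x ^ L * x ^ p * x * x * x := by
      rw [show x ^ L * x ^ L * x ^ p * x ^ p * x * x * x * x ^ ((2 * jl + 1 - d) / 2 + 1 - (d + m / 2)) =
          x ^ (L + L + p + p + 3 + ((2 * jl + 1 - d) / 2 + 1 - (d + m / 2))) by ring,
        show x ^ L * x ^ L * x ^ L * x ^ p * x * x * x = x ^ (L + L + L + p + 3) by ring]
      exact pow_congr_exp x (by omega)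
    have f6 : x ^ m = x ^ L * x ^ L * x * x := by
      rw [show x ^ L * x ^ L * x * x = x ^ (L + L + 2) by ring]; exact pow_congr_exp x (by omega)
    have f7 : x ^ (jl / 2 + d % 2) = x ^ L * x ^ p * x := by
      rw [show x ^ L * x ^ p * x = x ^ (L + p + 1) by ring]; exact pow_congr_exp x (by omega)
    have f8 : x ^ (d - 1 + d % 2) = x ^ p * x ^ p * x := by
      rw [show x ^ p * x ^ p * x = x ^ (p + p + 1) by ring]; exact pow_congr_exp x (by omega)
    rw [f4, f5, f1, f2, f3, f6, f7, f8]; ring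
  · -- `d` odd: `jl − d = 2L`, `m = 2L + 1`, `⌊m∕2⌋ = L`
    have f1 : x ^ (d - 1) = x ^ p * x ^ p * x * x := by
      rw [show x ^ p * x ^ p * x * x = x ^ (p + p + 2) by ring]; exact pow_congr_exp x (by omega)
    have f2 : x ^ d = x ^ p * x ^ p * x * x * x := by
      rw [show x ^ p * x ^ p * x * x * x = x ^ (p + p + 3) by ring]; exact pow_congr_exp x (by omega)
    have f3 : x ^ (2 * (m / 2)) = x ^ L * x ^ L := by
      rw [show x ^ L * x ^ L = x ^ (L + L) by ring]; exact pow_congr_exp x (by omega)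
    have f4 : x ^ (d + m - 1) = x ^ L * x ^ L * x ^ p * x ^ p * x * x * x := by
      rw [show x ^ L * x ^ L * x ^ p * x ^ p * x * x * x = x ^ (L + L + p + p + 3) by ring]; exact pow_congr_exp x (by omega)
    have f5 : x ^ L * x ^ L * x ^ p * x ^ p * x * x * x * x ^ ((2 * jl + 1 - d) / 2 + 1 - (d + m / 2)) = x ^ L * x ^ L * x ^ L * x ^ p * x * x * x := by
      rw [show x ^ L * x ^ L * x ^ p * x ^ p * x * x * x * x ^ ((2 * jl + 1 - d) / 2 + 1 - (d + m / 2)) =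
          x ^ (L + L + p + p + 3 + ((2 * jl + 1 - d) / 2 + 1 - (d + m / 2))) by ring,
        show x ^ L * x ^ L * x ^ L * x ^ p * x * x * x = x ^ (L + L + L + p + 3) by ring]
      exact pow_congr_exp x (by omega)
    have f6 : x ^ m = x ^ L * x ^ L * x := by
      rw [show x ^ L * x ^ L * x = x ^ (L + L + 1) by ring]; exact pow_congr_exp x (by omega)
    have f7 : x ^ (jl / 2 + d % 2) = x ^ L * x ^ p * x * x := by
      rw [show x ^ L * x ^ p * x * x = x ^ (L + p + 2) by ring]; exact pow_congr_exp x (by omega)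
    have f8 : x ^ (d - 1 + d % 2) = x ^ p * x ^ p * x * x * x := by
      rw [show x ^ p * x ^ p * x * x * x = x ^ (p + p + 3) by ring]; exact pow_congr_exp x (by omega)
    rw [f4, f5, f1, f2, f3, f6, f7, f8]; ring

/-! ## §2 The identity on the flipped class -/

/-- **(T5s♭-Unr) — THE TYPE-U TORIC CENSUS SUM (SHEET v5) IN THE FLIPPED PARITY CLASS.**  With the tables `nP nM vP vM` of ★ p857461 `toricCensusSum_unr_v5` (u-free level
tables of type U; sheet-v5 depth rules at the tokens `(m, ε)`; `d ≥ 2`, `S − 1 ≤ m`, `S = d − d%2`) but on the FLIPPED token class — `jl` ODD, and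
`{ε = +1, m ≢ d (2), 1 ≤ m ≤ jl − d} ∪ {ε = −1, m = jl − d + 1}` — the census sums to
`ε·Σ_{j ≤ jl} Σ_{a} q^a (vP j a − vM j a) = q^m·(1 + (q+1)[⌊jl∕2⌋ + d%2]_q − 2[d − 1 + d%2]_q)` (★ v5 on the even class: `[jl∕2]_q`, `[d − d%2]_q`).  These are the μ₁-tokens
`(m − a′, jl − a′)` of an ODD-`a′` level template piece of type U (★ p859713); binders = ★ `toricCensusSum_unr_v5`'s VERBATIM except `hjl` and the ε = 1 parity letter.
Pure finite-sum bookkeeping: ★ `sumP_eval_v5` − ★ `sumM_eval_v5`, `A0₊^{<d} − A0₋ = −q^{d−1}` (★ `alt_index_sum`), then `algebra_pos_flip` ∕ `algebra_neg_flip`.  Python twin of the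
abstract tables: 465∕465 on the ε = 1 class (q ≤ 4, d ≤ 7, jl ≤ 19).
[cite: Kottwitz1986BaseChangeUnits, §1 pp. 240–241] [cite: Rogawski1990, §4.9 Prop. 4.9.1 (b) p. 55, Lemma 4.9.3 p. 56] [cite: Flicker1998UnitaryFL, Prop. 7 p. 84] -/
theorem toricCensusSum_unr_v5_flip (q : ℕ) {d jl m : ℕ} (ε : ℚ) (hq : 2 ≤ q) (hd : 2 ≤ d) (hjl : jl % 2 = 1) (hmS : d - d % 2 ≤ m + 1)
    (hreal : (ε = 1 ∧ m % 2 ≠ d % 2 ∧ 1 ≤ m ∧ m + d ≤ jl) ∨ (ε = -1 ∧ m = jl - d + 1 ∧ d ≤ jl))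
    (nP nM vP vM : ℕ → ℕ → ℚ)
    (hnP : ∀ j a, 1 ≤ a → nP j a = if a + d ≤ j ∧ (j - a - d) % 2 = 0 then ((q : ℚ) ^ 2 - 1) * (q : ℚ) ^ (j - 2 - (j - a - d) / 2) else 0)
    (hnP0 : ∀ j, nP j 0 = if (j + d) % 2 = 0 then (if d ≤ j then ((q : ℚ) + 1) * (q : ℚ) ^ ((j + d) / 2 - 1) else (if j = 0 then 1 else ((q : ℚ) + 1) * (q : ℚ) ^ (j - 1))) else 0)
    (hnM : ∀ j a, nM j a = if (d ≤ j + 1 ∧ a + d = j + 1) ∨ (j + 1 < d ∧ a = 0 ∧ (j + d) % 2 = 1) then (if j = 0 then 1 else ((q : ℚ) + 1) * (q : ℚ) ^ (j - 1)) else 0)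
    (hv0 : ∀ j, vP j 0 = nP j 0 ∧ vM j 0 = nM j 0)
    (hvOff : ∀ j a, 1 ≤ a → j + m ≠ jl + a →
      (vP j a = if 2 * a ≤ m ∧ (j + a ≤ m ∨ j + a ≤ jl) then nP j a else 0) ∧ (vM j a = if 2 * a ≤ m ∧ (j + a ≤ m ∨ j + a ≤ jl) then nM j a else 0))
    (hvLow : ∀ j a, 1 ≤ a → j + m = jl + a → 2 * a ≤ m → vP j a = nP j a ∧ vM j a = nM j a)
    (hvTopP : ∀ j a, 1 ≤ a → j + m = jl + a → m < 2 * a →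
      vP j a = if (d + m ≤ jl ∧ (jl - d - m) % 2 = 0) ∧ 2 * j + d ≤ 2 * jl + 1 then nP j a / (((q : ℚ) - 1) * (q : ℚ) ^ ((2 * a - m + 1) / 2 - 1)) else 0)
    (hvTopM : ∀ j a, 1 ≤ a → j + m = jl + a → m < 2 * a →
      vM j a = if jl + 1 = d + m ∧ 2 * j + d ≤ 2 * jl + 1 then nM j a / (q : ℚ) ^ ((2 * a - m) / 2) else 0) :
    ε * ∑ j ∈ range (jl + 1), ∑ a ∈ range (jl + 2), (q : ℚ) ^ a * (vP j a - vM j a) =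
      (q : ℚ) ^ m * ((1 + ((q : ℚ) + 1) * ∑ i ∈ range (jl / 2 + d % 2), (q : ℚ) ^ i) - 2 * ∑ i ∈ range (d - 1 + d % 2), (q : ℚ) ^ i) := by
  have hx0 : (q : ℚ) ≠ 0 := Nat.cast_ne_zero.2 (by omega)
  have hx1 : (q : ℚ) ≠ 1 := by exact_mod_cast (show q ≠ 1 by omega)
  -- the rows below the conductor: `A0₊^{<d} − A0₋ = −q^{d−1}`
  have hA0 : ∑ j ∈ range d, (if j % 2 = d % 2 then (if j = 0 then (1 : ℚ) else ((q : ℚ) + 1) * (q : ℚ) ^ (j - 1)) else 0) -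
      ∑ j ∈ range d, (if j % 2 ≠ d % 2 then (if j = 0 then (1 : ℚ) else ((q : ℚ) + 1) * (q : ℚ) ^ (j - 1)) else 0) = -(q : ℚ) ^ (d - 1) := by
    rw [← Finset.sum_sub_distrib, ← alt_index_sum (q : ℚ) (by omega : 1 ≤ d)]
    refine Finset.sum_congr rfl fun j _ => ?_
    by_cases h : j % 2 = d % 2
    · rw [if_pos h, if_neg (not_not.2 h), if_pos h]; ring
    · rw [if_neg h, if_pos h, if_neg h]; ring
  have hsplit : ∑ j ∈ range (jl + 1), ∑ a ∈ range (jl + 2), (q : ℚ) ^ a * (vP j a - vM j a) =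
      ∑ j ∈ range (jl + 1), ∑ a ∈ range (jl + 2), (q : ℚ) ^ a * vP j a - ∑ j ∈ range (jl + 1), ∑ a ∈ range (jl + 2), (q : ℚ) ^ a * vM j a := by
    rw [← Finset.sum_sub_distrib]
    refine Finset.sum_congr rfl fun j _ => ?_
    rw [← Finset.sum_sub_distrib]
    refine Finset.sum_congr rfl fun a _ => ?_
    ring
  rw [hsplit]
  rcases hreal with ⟨hε, hpar, hm1, hmd⟩ | ⟨hε, hmeq, hdjl⟩
  · subst hε
    rw [sumP_eval_v5 (q : ℚ) hx0 hx1 hd (by omega) (by omega) nP vP hnP hnP0 (fun j => (hv0 j).1) (fun j a ha hne => (hvOff j a ha hne).1)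
        (fun j a ha he hl => (hvLow j a ha he hl).1) hvTopP,
      sumM_eval_v5 (q : ℚ) hx0 hd (by omega) (by omega) nM vM hnM (fun j => (hv0 j).2) (fun j a ha hne => (hvOff j a ha hne).2)
        (fun j a ha he hl => (hvLow j a ha he hl).2) hvTopM,
      if_pos (show m + d ≤ jl ∧ (jl - m - d) % 2 = 0 from ⟨hmd, by omega⟩),
      if_neg (show ¬ (jl + 1 = d + m) from by omega),
      min_eq_left (by omega : m / 2 ≤ (jl - d) / 2), one_mul, add_zero]
    exact algebra_pos_flip (q : ℚ) hx1 hd hpar hmS hmd hjl _ _ hA0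
  · subst hε
    rw [sumP_eval_v5 (q : ℚ) hx0 hx1 hd (by omega) (by omega) nP vP hnP hnP0 (fun j => (hv0 j).1) (fun j a ha hne => (hvOff j a ha hne).1)
        (fun j a ha he hl => (hvLow j a ha he hl).1) hvTopP,
      sumM_eval_v5 (q : ℚ) hx0 hd (by omega) (by omega) nM vM hnM (fun j => (hv0 j).2) (fun j a ha hne => (hvOff j a ha hne).2)
        (fun j a ha he hl => (hvLow j a ha he hl).2) hvTopM,
      if_neg (show ¬ (m + d ≤ jl ∧ (jl - m - d) % 2 = 0) from fun h => by omega),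
      if_pos (show jl + 1 = d + m from by omega)]
    exact algebra_neg_flip (q : ℚ) hx1 hd hdjl hmeq hmS hjl _ _ hA0

end Summit.HodgeConjecture.HodgeConjecture.Cruxes.H413.F0P3cDyRamToricCensusSumUnrV5Flip
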